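import Mathlib
import HarnessLib
import Summits.ResolutionOfSingularities.ResolutionOfSingularities.Theorems.WildQuotientsWildQuotientResolutionAffineQuotientBlowupModel
import Summits.ResolutionOfSingularities.ResolutionOfSingularities.Theorems.WildQuotientsWildQuotientResolutionConductorOneFrameSeamData
import Summits.ResolutionOfSingularities.ResolutionOfSingularities.Theorems.WildQuotientsWildQuotientResolutionConductorOneFrameSeparation

/-!
# S2 brick F3 — THE FRAME of the conductor-𝟙 core: lead-1's `FrameBrick k p n σ` (HF), literally

(crux stmt-ResolutionOfSingularities-15640 `WildQuotients.WildQuotientResolution`, line `Sketch`; chain w45c post-V5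
programme S2 «conductor-𝟙 core», design `L/res-L1-w45c-lead-1/S2-DESIGN.md` §1/§5/§6 brick F3; lead-1 F8 SIG
`L/res-L1-w45c-lead-1/stubs/ConductorOneF8Sig.lean` d7f6f5f4537369e2 (`ConductorOne.FrameBrick` = the HF binder of
`conductorOneCore_hasResolution_of_bricks`); res-L1-w45c-plan-1 RULING 2026-08-27T17:31:45Z (1) («033's F3 file must
END with a theorem whose statement is HF LITERALLY»), 18:23:36Z, NO OBJECTION 18:26:16Z / 19:44:04Z. [OURS · L1 W4.5c]
— NOT a statement of any manuscript; replaces the role of no printed item; AI-produced, weaker than expert review.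
Def-free. Prover res-D-pv-033.)

**`frameBrick`** — for `1 ≤ n` and `σ` with the F1 law `σ uᵢ·(1+uᵢ) = uᵢ`: the literal `FrameBrick k p n σ`
statement (with lead-1's `coreQuotMap` inlined): the action `ρ` on `Spec Aₙ` (`AffineQuotient.exists_specAction`),
`V = Bl_𝔪 Spec Aₙ` proper birational integral (F3a), the lifted action `ρB` over `Spec Aₙ^σ`
(`AffineQuotient.exists_actionOver_liftAction`, `hJ` = F3a `idealSheaf_core_comap`), the stable affine pieces
`O I = D₊(N_{min I, I})` (F3b/F3c-2b), their cover (F3b `iSup_piece_eq_top`), the seams `e I hI = Ω⁻¹ ≫ A` and the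
transported generator `τ I hI` with the diagonal-Möbius laws and the invariants clause (F3c-5′
`exists_pieceSeamData`), and the boolean-point separation (F3c-6 `pieces_separated`).
-/

-- single-problem summit: the doubled namespace component `ResolutionOfSingularities` is forced
set_option linter.dupNamespace false

noncomputable section

open CategoryTheory AlgebraicGeometry TopologicalSpace MvPolynomial Polynomial HomogeneousLocalization
open scoped Pointwise
open Literature.AlgebraicGeometry.Resolution Literature.AlgebraicGeometry.RelativeSpec

namespace Summit.ResolutionOfSingularities.ResolutionOfSingularities.Theorems.WildQuotientResolution.ConductorOne

variable (k : Type) [Field k] (p n : ℕ) [Fact p.Prime] [CharP k p]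
  (σ : CoreRing k p n ≃ₐ[k] CoreRing k p n)

/-- the Rees generator `uₗ t` -/
local notation3 (prettyPrint := false) "uT" l =>
  reesT (I := Ideal.span (Set.range (coreU k p n))) (coreU k p n l)
    (Ideal.mem_span_range_self (f := coreU k p n) (x := l))
/-- the Rees element `(uᵢ − uₗ) t` -/
local notation3 (prettyPrint := false) "dT" i:max l:max =>
  reesT (I := Ideal.span (Set.range (coreU k p n))) (coreU k p n i - coreU k p n l)
    (Ideal.sub_mem _ (Ideal.mem_span_range_self (f := coreU k p n) (x := i))
      (Ideal.mem_span_range_self (f := coreU k p n) (x := l)))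
/-- the norm factor `(u_l t)^p · w_l` -/
local notation3 (prettyPrint := false) "nT" l =>
  ((uT l) ^ p * algebraMap (CoreRing k p n) (reesAlgebra (Ideal.span (Set.range (coreU k p n))))
    (((isUnit_coreFactor k p n l).unit⁻¹ : (CoreRing k p n)ˣ) : CoreRing k p n))
/-- the norm factor `((uᵢ−u_l) t)^p · wᵢ w_l` -/
local notation3 (prettyPrint := false) "nDT" i:max l:max =>
  ((dT i l) ^ p * algebraMap (CoreRing k p n) (reesAlgebra (Ideal.span (Set.range (coreU k p n))))
    ((((isUnit_coreFactor k p n i).unit⁻¹ * (isUnit_coreFactor k p n l).unit⁻¹ : (CoreRing k p n)ˣ)) :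
      CoreRing k p n))
/-- the norm element `N_{i,I}` -/
local notation3 (prettyPrint := false) "normElt" i:max I:max =>
  ((nT i) * (∏ l ∈ Finset.erase I i, (nT l)) * (∏ l ∈ Finset.univ \ I, (nDT i l)))
/-- the piece `O_{i,I} = D₊(N_{i,I})` -/
local notation3 (prettyPrint := false) "pieceO" i:max I:max =>
  (Proj.basicOpen (reesGrading (Ideal.span (Set.range (coreU k p n)))) (normElt i I) :
    (affineBlowup (Ideal.span (Set.range (coreU k p n)))).Opens)

-- the HF statement is one large ∃; head-room
set_option maxHeartbeats 8000000 in
/-- **THE FRAME BRICK (HF) of the conductor-𝟙 core** — literally lead-1's `ConductorOne.FrameBrick k p n σ`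
(`stubs/ConductorOneF8Sig.lean` d7f6f5f4537369e2, with `coreQuotMap` inlined), for `1 ≤ n` and the F1 law.
[OURS · L1 W4.5c] -/
theorem frameBrick (hn : 1 ≤ n) (hσ : ∀ i, σ (coreU k p n i) * (1 + coreU k p n i) = coreU k p n i) :
    ∃ (ρ : ↥(Subgroup.zpowers σ) →* Aut (Spec (CommRingCat.of (CoreRing k p n))))
      (_ : ∀ g : ↥(Subgroup.zpowers σ), (ρ g).hom = Spec.map (CommRingCat.ofHom
        ((MulSemiringAction.toRingEquiv (↥(Subgroup.zpowers σ)) (CoreRing k p n) g⁻¹ :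
          CoreRing k p n ≃+* CoreRing k p n) : CoreRing k p n →+* CoreRing k p n)))
      (V : Scheme.{0}) (π : V ⟶ Spec (CommRingCat.of (CoreRing k p n))) (_ : IsProper π)
      (_ : IsBirational π) (_ : IsIntegral V)
      (ρB : ActionOver (π ≫ Spec.map (CommRingCat.ofHom (algebraMap
        (FixedPoints.subalgebra k (CoreRing k p n) ↥(Subgroup.zpowers σ)) (CoreRing k p n)))) ↥(Subgroup.zpowers σ))
      (_ : ∀ g : ↥(Subgroup.zpowers σ), (ρB.aut g).hom ≫ π = π ≫ (ρ g).hom)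
      (O : {I : Finset (Fin n) // I.Nonempty} → ρB.StableAffineOpens)
      (_ : ⨆ I, (O I).1 = ⊤)
      (e : ∀ (I : Finset (Fin n)) (hI : I.Nonempty),
        Γ(((O ⟨I, hI⟩).1 : Scheme.{0}), ((O ⟨I, hI⟩).1.ι ≫ (π ≫ Spec.map (CommRingCat.ofHom (algebraMap
          (FixedPoints.subalgebra k (CoreRing k p n) ↥(Subgroup.zpowers σ)) (CoreRing k p n))))) ⁻¹ᵁ ⊤) ≃+*
          ChartRing k p n (I.min' hI) I)
      (τ : ∀ (I : Finset (Fin n)) (hI : I.Nonempty),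
        ChartRing k p n (I.min' hI) I →ₐ[k] ChartRing k p n (I.min' hI) I)
      (_ : ∀ (I : Finset (Fin n)) (hI : I.Nonempty), IsChartAction k p n (I.min' hI) I
        (τ I hI : ChartRing k p n (I.min' hI) I →+* ChartRing k p n (I.min' hI) I))
      (_ : ∀ (I : Finset (Fin n)) (hI : I.Nonempty) (x),
        x ∈ (ρB.restrict (O ⟨I, hI⟩).1 (O ⟨I, hI⟩).2.1).invariantsRing ⊤ ↔ τ I hI (e I hI x) = e I hI x),
      ∀ (I : Finset (Fin n)) (hI : I.Nonempty) (I' : Finset (Fin n)) (hI' : I'.Nonempty), I ≠ I' →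
        Disjoint (((O ⟨I', hI'⟩).1 : Set V))
          ((O ⟨I, hI⟩).1.ι.base '' (((O ⟨I, hI⟩).1 : Scheme.{0}).zeroLocus
            ((e I hI).symm '' Set.range (chartX k p n (I.min' hI) I)))) := by
  -- the action on `Spec Aₙ` and the stable centre (no `obtain`: the goal is large)
  let ρ : ↥(Subgroup.zpowers σ) →* Aut (Spec (CommRingCat.of (CoreRing k p n))) :=
    (AffineQuotient.exists_specAction (CoreRing k p n) ↥(Subgroup.zpowers σ)).choose
  have hρ : ∀ g : ↥(Subgroup.zpowers σ), (ρ g).hom = Spec.map (CommRingCat.ofHom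
      ((MulSemiringAction.toRingEquiv (↥(Subgroup.zpowers σ)) (CoreRing k p n) g⁻¹ :
        CoreRing k p n ≃+* CoreRing k p n) : CoreRing k p n →+* CoreRing k p n)) :=
    (AffineQuotient.exists_specAction (CoreRing k p n) ↥(Subgroup.zpowers σ)).choose_spec
  have hJ := idealSheaf_core_comap k p n σ hσ ρ hρ
  have hVπ := core_blowup_integral_proper_birational k p n hn
  -- the lifted action over `Spec Aₙ^σ`
  have hex := AffineQuotient.exists_actionOver_liftAction k ↥(Subgroup.zpowers σ) ρ hρ
    (affineBlowup.isBlowup (Ideal.span (Set.range (coreU k p n)))) hJ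
  let ρB := hex.choose
  have hρB : ρB.aut = (affineBlowup.isBlowup (Ideal.span (Set.range (coreU k p n)))).liftAction ρ hJ :=
    hex.choose_spec
  have haut : ∀ g, (ρB.aut g).hom =
      (((affineBlowup.isBlowup (Ideal.span (Set.range (coreU k p n)))).liftAction ρ hJ) g).hom := fun g => by
    rw [hρB]
  -- the pieces
  have hstab : ∀ (I : {I : Finset (Fin n) // I.Nonempty}) (g : ↥(Subgroup.zpowers σ)),
      (ρB.aut g).hom ⁻¹ᵁ (pieceO (I.1.min' I.2) I.1) = (pieceO (I.1.min' I.2) I.1) :=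
    fun I g => preimage_normPiece_eq k p n σ hσ (I.1.min' I.2) I.1 ρ hρ hJ _ ρB haut g
  have haff : ∀ (I : {I : Finset (Fin n) // I.Nonempty}),
      IsAffineHom ((pieceO (I.1.min' I.2) I.1).ι ≫ affineBlowup.π (Ideal.span (Set.range (coreU k p n))) ≫
        Spec.map (CommRingCat.ofHom (algebraMap
          (FixedPoints.subalgebra k (CoreRing k p n) ↥(Subgroup.zpowers σ)) (CoreRing k p n)))) := by
    intro I
    haveI : IsAffine ((pieceO (I.1.min' I.2) I.1 : (affineBlowup (Ideal.span (Set.range (coreU k p n)))).Opens) :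
        Scheme.{0}) :=
      Proj.isAffineOpen_basicOpen _ _ (normElt_mem k p n (I.1.min' I.2) I.1) (normElt_deg_pos p n (I.1.min' I.2) I.1)
    infer_instance
  let O : {I : Finset (Fin n) // I.Nonempty} → ρB.StableAffineOpens :=
    fun I => ⟨pieceO (I.1.min' I.2) I.1, hstab I, haff I⟩
  have hO1 : ∀ I, (O I).1 = (pieceO (I.1.min' I.2) I.1) := fun I => rfl
  -- the cover
  have hcov : ⨆ I, (O I).1 = ⊤ := by
    simp_rw [hO1, basicOpen_normElt_eq]
    exact iSup_piece_eq_top k p n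
  -- the seam data of every piece
  have hseam := fun (I : Finset (Fin n)) (hI : I.Nonempty) =>
    exists_pieceSeamData k p n σ hσ (I.min' hI) I (Finset.min'_mem I hI) ρ hρ hJ _ ρB haut
      (O ⟨I, hI⟩).1 rfl (O ⟨I, hI⟩).2.1
  choose β Ω A τ hβi hβI hβO hA hpts hτβ hequi hact hinv using hseam
  refine ⟨ρ, hρ, affineBlowup (Ideal.span (Set.range (coreU k p n))),
    affineBlowup.π (Ideal.span (Set.range (coreU k p n))), hVπ.2.1, hVπ.2.2, hVπ.1, ρB, fun g => ?_, O, hcov,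
    fun I hI => (Ω I hI).symm.trans (A I hI), τ, hact, hinv, fun I hI I' hI' hne => ?_⟩
  · rw [haut]; exact (affineBlowup.isBlowup _).liftAction_hom_comp ρ hJ g
  · exact pieces_separated k p n (I.min' hI) I hI rfl I' hI' hne _ (O ⟨I, hI⟩).1 (O ⟨I', hI'⟩).1 rfl rfl
      (β I hI) (hβi I hI) (hβI I hI) (hβO I hI) (Ω I hI) (A I hI) (hA I hI) (hpts I hI)

end Summit.ResolutionOfSingularities.ResolutionOfSingularities.Theorems.WildQuotientResolution.ConductorOne

end
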